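import Summits.ABC.ABC.Theorems.DefiniteXiDefiniteRTControlPrime
import HarnessLib

/-!
# Stub-ideation sketch (ideator k2, generation 4, FAMILY 2 — RESHAPE) for `stub_takahashi`

Crux `Summit.ABC.ABC.Theses.DefiniteXi.DefiniteRTControlPrime` (stmt-ABC-11338), stub
`theorem stub_takahashi : takahashi2001_thm_2_3_of_coprime` (named fact).

Elaboration sanity only (companion of `STUB-IDEAS-stub_takahashi-2.md`, gen 4). Content:

* **R1 — the cokernel square law** (weaken-and-bootstrap): Takahashi's adjunction package WITHOUT
  optimality (`π_*` onto) already gives `c_r(W) · deg φ_P = ξ · j_P²` and `j_P ∣ c_r(W) · π_*(y)`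
  for every `y`, hence `deg φ_P ≤ ξ · c_r(W) · m²` for ANY `m > 0` in the image of `π_*`
  (`sq_law_of_brandtData`, `j_dvd_of_brandtData`, `modularDegree_le_of_brandtData_cokernel` —
  PROVED here, pure algebra over the tree's `xi_lFunction_eq_sum`). The geometric content moves to
  "`m` = toric exponent of `λ^∨` divides `#ker λ`" (`brandtDictionaryCokernel_of_coprime`, a
  statement-level package, NOT a verbatim printed theorem), and the crux then needs neither the
  conductor-restricted pivot, nor Carayol, nor Pasten's Lemma 6.8 (`card_ker_le_163_of_minimal`,
  `definiteRTControlPrime_of_cokernelDictionary`: statements, `sorry`).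
-/

noncomputable section

open scoped BigOperators
open Literature.NumberTheory.EllipticCurves Literature.NumberTheory.EllipticCurves.ModularForms
open Literature.NumberTheory.Automorphic
open WeierstrassCurve
open Summit.ABC.ABC.Theses.DefiniteXi Summit.ABC.ABC.Theorems.DefiniteRTControlPrime

namespace Summit.ABC.ABC.Cruxes.DefiniteRTControlPrime.StubIdeas2G4

/-! ## R1 (a): the square law `c_r · δ_P = ξ · j²` — no surjectivity of `π_*` used -/

/-- **Square law.** In Takahashi's Brandt package for an ARBITRARY parametrised curve `W` of the
class (adjunction for Gross's pairing with `u_W(a,b) = c_r(W) a b`, `π_* π^* 1 = deg φ_P`,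
`π^* 1 = j g`, `g` generating the `a(W)`-eigen-line): `c_r(W) · deg φ_P = ξ_S · j²`.
Takahashi 2001, proof of Thm. 2.3 (p. 80: `δ c_r = j_r² h_r`), with optimality nowhere used. [cite: Takahashi2001, Thm. 2.3 (proof, p. 80)] -/
theorem sq_law_of_brandtData (W : WeierstrassCurve ℚ) [W.IsElliptic] (M r : ℕ) [NeZero (M * r)]
    (P : ModularParametrizationData W (M * r)) (S : Brandt.XiSetup M r)
    [Fintype (Brandt.ClassSet S.O)] (X : Submodule ℤ (Brandt.ClassSet S.O → ℤ)) (pb : ℤ →ₗ[ℤ] X)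
    (pf : X →ₗ[ℤ] ℤ) (g : X) (j : ℤ)
    (hadj : ∀ (a : ℤ) (y : X),
      ∑ i, (Brandt.weight S.O i : ℤ) * (pb a : Brandt.ClassSet S.O → ℤ) i *
          (y : Brandt.ClassSet S.O → ℤ) i =
        ((W.minimalDiscriminantNorm ℤ).factorization r : ℤ) * a * pf y)
    (hδ : pf (pb 1) = (P.modularDegree : ℤ)) (hg : pb 1 = j • g)
    (hL : Brandt.eigenLattice (M * r) (Brandt.matrix S.O) (fun n => W.LFunction n) =
      ℤ ∙ (g : Brandt.ClassSet S.O → ℤ)) :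
    ((W.minimalDiscriminantNorm ℤ).factorization r : ℤ) * P.modularDegree =
      (S.xi (fun n => W.LFunction n) : ℤ) * j ^ 2 := by
  classical
  have hg0 : (g : Brandt.ClassSet S.O → ℤ) ≠ 0 := by
    intro h0
    have hg' : g = 0 := by ext i; exact congrFun h0 i
    have h1 := hδ
    rw [hg, hg', smul_zero, map_zero] at h1
    have h2 : P.modularDegree = 0 := by exact_mod_cast h1.symm
    exact P.deg_pos.ne' h2
  have hxi : S.xi (fun n => W.LFunction n) =
      ∑ i, Brandt.weight S.O i * ((g : Brandt.ClassSet S.O → ℤ) i).natAbs ^ 2 :=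
    xi_lFunction_eq_sum W S hg0 hL
  have h := hadj 1 (pb 1)
  rw [mul_one, hδ] at h
  have hcoe : ((pb 1 : X) : Brandt.ClassSet S.O → ℤ) = j • (g : Brandt.ClassSet S.O → ℤ) := by
    rw [hg]; rfl
  rw [hcoe] at h
  rw [← h, hxi, Nat.cast_sum, Finset.sum_mul]
  refine Finset.sum_congr rfl fun i _ => ?_
  simp only [Pi.smul_apply, smul_eq_mul]
  push_cast
  rw [sq_abs]
  ring

/-! ## R1 (b): `j ∣ c_r · π_*(y)` for every `y ∈ X` -/

/-- **Index divisibility.** From the adjunction at `a = 1`: `j · ⟨g, y⟩_w = c_r(W) · π_*(y)`, so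
`j ∣ c_r(W) · π_*(y)` for every `y ∈ X`; with `π_*` onto this is Takahashi's `j_r ∣ c_r`, in
general it bounds `|j| ≤ c_r · m` for any positive `m ∈ π_*(X)`. [cite: Takahashi2001, Thm. 2.3 (proof, p. 80)] -/
theorem j_dvd_of_brandtData {M r : ℕ} (W : WeierstrassCurve ℚ) (S : Brandt.XiSetup M r)
    [Fintype (Brandt.ClassSet S.O)] (X : Submodule ℤ (Brandt.ClassSet S.O → ℤ)) (pb : ℤ →ₗ[ℤ] X)
    (pf : X →ₗ[ℤ] ℤ) (g : X) (j : ℤ)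
    (hadj : ∀ (a : ℤ) (y : X),
      ∑ i, (Brandt.weight S.O i : ℤ) * (pb a : Brandt.ClassSet S.O → ℤ) i *
          (y : Brandt.ClassSet S.O → ℤ) i =
        ((W.minimalDiscriminantNorm ℤ).factorization r : ℤ) * a * pf y)
    (hg : pb 1 = j • g) (y : X) :
    j ∣ ((W.minimalDiscriminantNorm ℤ).factorization r : ℤ) * pf y := by
  have h := hadj 1 y
  rw [mul_one] at h
  have hcoe : ((pb 1 : X) : Brandt.ClassSet S.O → ℤ) = j • (g : Brandt.ClassSet S.O → ℤ) := by
    rw [hg]; rfl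
  rw [hcoe] at h
  refine ⟨∑ i, (Brandt.weight S.O i : ℤ) * (g : Brandt.ClassSet S.O → ℤ) i *
    (y : Brandt.ClassSet S.O → ℤ) i, ?_⟩
  rw [← h, Finset.mul_sum]
  refine Finset.sum_congr rfl fun i _ => ?_
  simp only [Pi.smul_apply, smul_eq_mul]
  ring

/-! ## R1 (c): the optimality-free Ribet–Takahashi inequality `deg φ_P ≤ ξ · c_r(W) · m²` -/

/-- **Cokernel bound.** For ANY parametrised `W` of conductor `M r` (`r` prime) and any positive
`m` in the image of `π_*` (e.g. the index `m_P = [X_r(W) : π_*(X_r(J))]`):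
`deg φ_P ≤ ξ_S · c_r(W) · m²`. For the optimal curve (`m = 1`) this is the inequality
`δ ≤ ξ · c_r` the crux consumes (`takahashi2001_thm_2_3_of_coprime.modularDegree_le_xi_mul`). [cite: Takahashi2001, Thm. 2.3 (p. 79), remark p. 80] -/
theorem modularDegree_le_of_brandtData_cokernel (W : WeierstrassCurve ℚ) [W.IsElliptic] (M r : ℕ)
    [NeZero (M * r)] (hr : r.Prime) (hN : W.conductorNorm ℤ = M * r)
    (P : ModularParametrizationData W (M * r)) (S : Brandt.XiSetup M r)
    [Fintype (Brandt.ClassSet S.O)] (X : Submodule ℤ (Brandt.ClassSet S.O → ℤ)) (pb : ℤ →ₗ[ℤ] X)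
    (pf : X →ₗ[ℤ] ℤ) (g : X) (j : ℤ)
    (hadj : ∀ (a : ℤ) (y : X),
      ∑ i, (Brandt.weight S.O i : ℤ) * (pb a : Brandt.ClassSet S.O → ℤ) i *
          (y : Brandt.ClassSet S.O → ℤ) i =
        ((W.minimalDiscriminantNorm ℤ).factorization r : ℤ) * a * pf y)
    (hδ : pf (pb 1) = (P.modularDegree : ℤ)) (hg : pb 1 = j • g)
    (hL : Brandt.eigenLattice (M * r) (Brandt.matrix S.O) (fun n => W.LFunction n) =
      ℤ ∙ (g : Brandt.ClassSet S.O → ℤ))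
    (m : ℕ) (hm0 : 0 < m) (hm : ∃ y : X, pf y = m) :
    P.modularDegree ≤ S.xi (fun n => W.LFunction n) *
      (W.minimalDiscriminantNorm ℤ).factorization r * m ^ 2 := by
  obtain ⟨y, hy⟩ := hm
  set c : ℕ := (W.minimalDiscriminantNorm ℤ).factorization r with hc_def
  -- `c_r = ord_r Δ_min > 0`: `r ∣ N_W = M r ∣ Δ_min ≠ 0` (as in `Takahashi2001.exists_ij_of_brandtData`)
  have hc0 : 0 < c := by
    have hfin := WeierstrassCurve.finite_setOf_ordMinimalDiscriminant_ne_zero_holds (A := ℤ) W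
    have hdvd : W.conductorNorm ℤ ∣ W.minimalDiscriminantNorm ℤ :=
      W.conductorNorm_dvd_minimalDiscriminantNorm hfin
    have hpos : 0 < W.minimalDiscriminantNorm ℤ := W.minimalDiscriminantNorm_pos_holds
    have hrd : r ∣ W.minimalDiscriminantNorm ℤ :=
      dvd_trans ⟨M, by rw [hN, mul_comm]⟩ hdvd
    exact hr.factorization_pos_of_dvd hpos.ne' hrd
  have hsq := sq_law_of_brandtData W M r P S X pb pf g j hadj hδ hg hL
  have hjd := j_dvd_of_brandtData W S X pb pf g j hadj hg y
  rw [hy] at hjd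
  -- `|j| ≤ c m`
  have hjle : j.natAbs ≤ c * m := by
    have h1 : j.natAbs ∣ c * m := by
      have h2 := Int.natAbs_dvd_natAbs.mpr hjd
      simpa [Int.natAbs_mul, Int.natAbs_natCast] using h2
    exact Nat.le_of_dvd (Nat.mul_pos hc0 hm0) h1
  -- `c δ = ξ |j|²` in `ℕ`
  have key : c * P.modularDegree = S.xi (fun n => W.LFunction n) * j.natAbs ^ 2 := by
    have h2 : ((c * P.modularDegree : ℕ) : ℤ) =
        ((S.xi (fun n => W.LFunction n) * j.natAbs ^ 2 : ℕ) : ℤ) := by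
      push_cast
      rw [sq_abs]
      exact hsq
    exact_mod_cast h2
  have h3 : c * P.modularDegree ≤ c * (S.xi (fun n => W.LFunction n) * c * m ^ 2) := by
    rw [key]
    calc S.xi (fun n => W.LFunction n) * j.natAbs ^ 2
        ≤ S.xi (fun n => W.LFunction n) * (c * m) ^ 2 :=
          Nat.mul_le_mul_left _ (Nat.pow_le_pow_left hjle 2)
      _ = c * (S.xi (fun n => W.LFunction n) * c * m ^ 2) := by ring
  exact Nat.le_of_mul_le_mul_left h3 hc0

/-! ## R1 (d): the optimality-free package as ONE statement (typed; the geometric debt) -/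

/-- **The cokernel dictionary at `r ∥ N` (statement-level package; NOT a verbatim printed
theorem).** For EVERY elliptic `W/ℚ` of conductor `M r` (`r` prime, `gcd(M, r) = 1`) and EVERY
datum `P` at level `M r` (no minimality of any kind), in SOME Brandt setup `S₀` of type `(M, r)`
(the Eichler order cut out by the supersingular points, Takahashi p. 84): the character group
`X = X_r(J₀(Mr)) ⊆ ℤ^{Cls O}` (Ribet/Kohel isometry), `π^* : ℤ → X`, `π_* : X → ℤ` adjoint for
Grothendieck's pairings (`u_W(a,b) = ord_r Δ_min(W) · a b`, Tate curve), `π_* π^* 1 = deg φ_P`,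
`π^* 1 = j g` with `g` generating the `a(W)`-eigen-line (multiplicity one), and a positive
`m ∈ π_*(X)` with `m ∣ #ker(ℂ/Λ_f → ℂ/Λ_W)` — the toric exponent of `λ^∨` for the isogeny
`λ : E_f → W` (degree `#ker P.isogenyMap`) through which `φ_P` factors (`π_{P,*} = λ^∨_* ∘ π_{0,*}`,
`π_{0,*}` onto for the optimal quotient). The optimal case `m = 1` is exactly the hypothesis of
`takahashi2001_thm_2_3_of_coprime_of_brandtDictionary_one`. Sources for the pieces: SGA7 IX 11.5
(functoriality of the monodromy pairing), Conrad–Stein 2001 §7.1, Kohel 2001 Thm. 4.3 (`D = 1`),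
Takahashi 2001 §2; the clause `m ∣ #ker λ` is folklore (an isogeny of Tate curves is `x ↦ x^a`
on the tori with `a ∣ deg`). [cite: Takahashi2001, §2 p. 78 and proof of Thm. 3.8 p. 84] [cite: ConradStein2001, §7.1] [cite: Kohel2001, Thm. 4.3] -/
def brandtDictionaryCokernel_of_coprime : Prop :=
  ∀ (W : WeierstrassCurve ℚ) [W.IsElliptic] (M r : ℕ) [NeZero (M * r)],
    r.Prime → M.Coprime r → W.conductorNorm ℤ = M * r →
    ∀ P : ModularParametrizationData W (M * r), Nonempty (Brandt.XiSetup M r) →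
      ∃ (S₀ : Brandt.XiSetup M r) (_ : Fintype (Brandt.ClassSet S₀.O))
        (X : Submodule ℤ (Brandt.ClassSet S₀.O → ℤ)) (pb : ℤ →ₗ[ℤ] X) (pf : X →ₗ[ℤ] ℤ)
        (g : X) (j : ℤ) (m : ℕ),
        (∀ (a : ℤ) (y : X),
            ∑ i, (Brandt.weight S₀.O i : ℤ) * (pb a : Brandt.ClassSet S₀.O → ℤ) i *
                (y : Brandt.ClassSet S₀.O → ℤ) i =
              ((W.minimalDiscriminantNorm ℤ).factorization r : ℤ) * a * pf y) ∧
        pf (pb 1) = (P.modularDegree : ℤ) ∧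
        pb 1 = j • g ∧
        Brandt.eigenLattice (M * r) (Brandt.matrix S₀.O) (fun n => W.LFunction n) =
          ℤ ∙ (g : Brandt.ClassSet S₀.O → ℤ) ∧
        0 < m ∧ (∃ y : X, pf y = m) ∧ m ∣ Nat.card P.isogenyMap.ker

/-- **R1 assembled at the package level (PROVED modulo the package):** for every parametrised `W`
of conductor `M r` and every datum `P`, `deg φ_P ≤ ξ(W; M, r) · c_r(W) · m²` with `m ∣ #ker λ_P`
(`ξ` = `brandtXi`, setup-independent by `Brandt.XiSetup.xi_eq_xi`). [cite: Takahashi2001, Thm. 2.3 (p. 79), remark p. 80] -/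
theorem modularDegree_le_of_cokernelDictionary (H : brandtDictionaryCokernel_of_coprime)
    (W : WeierstrassCurve ℚ) [W.IsElliptic] (M r : ℕ) [NeZero (M * r)] (hr : r.Prime)
    (hcop : M.Coprime r) (hN : W.conductorNorm ℤ = M * r)
    (P : ModularParametrizationData W (M * r)) :
    ∃ m : ℕ, 0 < m ∧ m ∣ Nat.card P.isogenyMap.ker ∧
      P.modularDegree ≤ brandtXi M r (fun n => W.LFunction n) *
        (W.minimalDiscriminantNorm ℤ).factorization r * m ^ 2 := by
  obtain ⟨S₀, _, X, pb, pf, g, j, m, hadj, hδ, hg, hL, hm0, hm, hdvd⟩ :=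
    H W M r hr hcop hN P (takahashi2001_thm_2_3_of_coprime.nonempty_xiSetup' hr hcop)
  obtain ⟨S, hS⟩ :=
    exists_brandtXi_eq (⟨S₀⟩ : Nonempty (Brandt.XiSetup M r)) (fun n => W.LFunction n)
  rw [hS, ← Brandt.XiSetup.xi_eq_xi S₀ S]
  exact ⟨m, hm0, hdvd,
    modularDegree_le_of_brandtData_cokernel W M r hr hN P S₀ X pb pf g j hadj hδ hg hL m hm0 hm⟩

/-! ## R1 (e): the two remaining steps toward the crux -/

/-- **`#ker λ ≤ 163` for a minimal datum of a curve** (from the route's `h163` and the tree's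
`modularDegree_eq_card_ker_mul` / `exists_optimalDatum'`: `deg φ_{D₁} = #ker λ · deg φ_{D₀}` and
`deg φ_{D₁} ≤ 163 · deg φ_{D₀}`). PROVED. [cite: PastenShimura2024, §3 p. 13] -/
theorem card_ker_le_163_of_minimal (h163 : PastenShimura2024_minimalDegree_le_163_mul)
    {N : ℕ} [NeZero N] {W : WeierstrassCurve ℚ} [W.IsElliptic] [W.IsGloballyMinimal]
    (D₁ : ModularParametrizationData W N)
    (hmin : ∀ D' : ModularParametrizationData W N, D₁.modularDegree ≤ D'.modularDegree) :
    Finite D₁.isogenyMap.ker ∧ Nat.card D₁.isogenyMap.ker ≤ 163 := by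
  obtain ⟨W₀, hW₀, D₀, hf₀, h₀⟩ := D₁.exists_optimalDatum'
  haveI := hW₀
  have hker₀ : D₀.isogenyMap.ker = ⊥ := D₀.isogenyMap_ker_eq_bot_iff.mpr h₀
  have hmin₀ : ∀ (W' : WeierstrassCurve ℚ) [W'.IsElliptic]
      (D' : ModularParametrizationData W' N), D'.f = D₀.f →
        D₀.modularDegree ≤ D'.modularDegree := fun W' _ D' hD' =>
    D₀.modularDegree_le_of_isogenyMap_ker_eq_bot hker₀ D' hD'
  have h163' : D₁.modularDegree ≤ 163 * D₀.modularDegree :=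
    h163 N W₀ W D₀ D₁ hf₀.symm hmin₀ hmin
  have hinj : Function.Injective D₀.isogenyMap := (AddMonoidHom.ker_eq_bot_iff _).mp hker₀
  obtain ⟨hfin, hdeg⟩ := D₁.modularDegree_eq_card_ker_mul hf₀.symm D₀.smul_periodLattice_le hinj
    D₀.deg_pos D₀.finite_setOf_natCard_fiberOrbits_ne
  refine ⟨hfin, ?_⟩
  have h1 : Nat.card D₁.isogenyMap.ker * D₀.deg ≤ 163 * D₀.deg := by
    have h2 := h163'
    rw [hdeg] at h2
    exact h2
  exact Nat.le_of_mul_le_mul_right h1 D₀.deg_pos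

/-- **The crux from the cokernel dictionary and `h163` alone** (`C = 4 · 163²`, `N^ε` idle):
`deg D ≤ 4 deg D₁ ≤ 4 ξ c_q(C • E) m² ≤ 4 · 163² ξ c_q(E)` — the square law at the global minimal
model `C • E` of the Frey curve ITSELF (`modularDegree_le_of_cokernelDictionary`,
`card_ker_le_163_of_minimal`, `minimalDiscriminantNorm_smul_rat`, `LFunction_smul`, and the
LANDED route lemmas `stub_freyLocal`, `stub_smulTransportDeg`, `stub_freyScale`); no pivot
`(W⋆, P⋆)`, no Carayol / `exists_isNewformOf`, no Lemma 6.8, no `stub_valTransport`. PROVED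
modulo `H` and `h163`. [cite: Takahashi2001, Thm. 2.3] [cite: PastenShimura2024, §3 p. 13] -/
theorem definiteRTControlPrime_of_cokernelDictionary (H : brandtDictionaryCokernel_of_coprime)
    (h163 : PastenShimura2024_minimalDegree_le_163_mul) :
    Summit.ABC.ABC.Theses.DefiniteXi.DefiniteRTControlPrime := by
  intro ε hε
  refine ⟨4 * 163 * 163, ?_⟩
  intro a b hab h0 N _ hN q hq hq2 hqN D hDmin
  -- `N = M q`
  obtain ⟨M, hM⟩ := hqN
  rw [mul_comm] at hM
  subst hM
  haveI := isElliptic_freyCurve h0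
  have hdiv : M * q / q = M := Nat.mul_div_cancel M hq.pos
  rw [hdiv]
  have hqN' : q ∣ (freyCurve a b).conductorNorm ℤ := by rw [hN]; exact Dvd.intro_left M rfl
  -- `gcd(M, q) = 1` (landed `stub_freyLocal`)
  have hcop : M.Coprime q := by
    have h := stub_freyLocal a b hab h0 q hq hq2 hqN'
    rwa [hN, hdiv] at h
  -- a global minimal model `W_m = C • E` and a minimal datum `D₁` of it
  obtain ⟨C, hC⟩ := hasGlobalMinimalModel_rat_holds (freyCurve a b)
  haveI := hC
  have hNm : (C • freyCurve a b).conductorNorm ℤ = M * q := by rw [conductorNorm_smul_rat, hN]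
  have hne : Nonempty (ModularParametrizationData (C • freyCurve a b) (M * q)) :=
    (Summit.ABC.ABC.Theorems.nonempty_modularParametrizationData_smul_iff C).mpr ⟨D⟩
  obtain ⟨D₁, -, hD₁min⟩ := exists_minimal_datum hne
  -- the cokernel square law at `(C • E, D₁)` — NO pivot, NO minimality over the class
  obtain ⟨m, hm0, hmdvd, hsq⟩ :=
    modularDegree_le_of_cokernelDictionary H (C • freyCurve a b) M q hq hcop hNm D₁
  rw [LFunction_smul, minimalDiscriminantNorm_smul_rat] at hsq
  -- `m ≤ #ker λ ≤ 163`
  have hm : m ≤ 163 := by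
    obtain ⟨hfin, hker⟩ := card_ker_le_163_of_minimal h163 D₁ hD₁min
    haveI := hfin
    exact (Nat.le_of_dvd Nat.card_pos hmdvd).trans hker
  -- (T_model) back to the Frey model (landed `stub_smulTransportDeg`, `stub_freyScale`)
  obtain ⟨D₁', -, hdeg₁'⟩ := stub_smulTransportDeg C D₁
  have hscale : (C.u : ℚ).num.natAbs ≤ 2 := stub_freyScale a b hab h0 C hC
  have hD : D.deg ≤ 4 * D₁.modularDegree := by
    calc D.deg ≤ D₁'.deg := hDmin D₁'
      _ = (C.u : ℚ).num.natAbs ^ 2 * D₁.deg := hdeg₁'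
      _ ≤ 2 ^ 2 * D₁.deg := Nat.mul_le_mul_right _ (Nat.pow_le_pow_left hscale 2)
      _ = 4 * D₁.modularDegree := by norm_num [ModularParametrizationData.modularDegree]
  -- the chain in `ℕ`
  set ξ : ℕ := brandtXi M q (fun n => (freyCurve a b).LFunction n) with hξ
  set v : ℕ := ((freyCurve a b).minimalDiscriminantNorm ℤ).factorization q with hv
  have hchain : D.deg ≤ 4 * 163 * 163 * (ξ * v) :=
    calc D.deg ≤ 4 * D₁.modularDegree := hD
      _ ≤ 4 * (ξ * v * m ^ 2) := Nat.mul_le_mul_left _ hsq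
      _ ≤ 4 * (ξ * v * 163 ^ 2) :=
          Nat.mul_le_mul_left _ (Nat.mul_le_mul_left _ (Nat.pow_le_pow_left hm 2))
      _ = 4 * 163 * 163 * (ξ * v) := by ring
  -- to `ℝ`, inserting the idle `N^ε ≥ 1`
  have hN1 : (1 : ℝ) ≤ ((M * q : ℕ) : ℝ) := by
    exact_mod_cast Nat.one_le_iff_ne_zero.mpr (NeZero.ne (M * q))
  have hrpow : (1 : ℝ) ≤ ((M * q : ℕ) : ℝ) ^ ε := Real.one_le_rpow hN1 hε.le
  have hcast : (D.deg : ℝ) ≤ (4 * 163 * 163 : ℝ) * ((ξ : ℝ) * (v : ℝ)) := by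
    exact_mod_cast hchain
  have hξv : (0 : ℝ) ≤ (ξ : ℝ) * (v : ℝ) := by positivity
  calc (D.deg : ℝ) ≤ (4 * 163 * 163 : ℝ) * ((ξ : ℝ) * (v : ℝ)) := hcast
    _ = (4 * 163 * 163 : ℝ) * 1 * ((ξ : ℝ) * (v : ℝ)) := by ring
    _ ≤ (4 * 163 * 163 : ℝ) * ((M * q : ℕ) : ℝ) ^ ε * ((ξ : ℝ) * (v : ℝ)) := by gcongr

end Summit.ABC.ABC.Cruxes.DefiniteRTControlPrime.StubIdeas2G4

end
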